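import Summits.Ventures.LatticeQCDFlow.Scoring.TorusParsevalAlternant
import Summits.Ventures.LatticeQCDFlow.Scoring.AlternantTorusExpansion
import Summits.Ventures.LatticeQCDFlow.Scoring.TorusParsevalPairing
import Summits.Ventures.LatticeQCDFlow.Scoring.UNTraceMomentsCentralPhase
import Literature.RingTheory.SymmetricFunctions.SchurPolynomials
import HarnessLib

/-!
# Weyl's orthogonality and the `U(N)` character coefficients of the Wilson weight, for every `N`: `∫ e^{x Σcos θ} conj s_λ(e^{iθ}) |Δ|² dθ = (2π)^N N! det[I_{|λ_i − i + j|}(x)]`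

HONEST FRAMING: exact (Metropolis-corrected) sampling algorithms for lattice gauge theory;
figures of merit are autocorrelation/cost numbers at stated couplings and volumes; no
continuum-physics claim.

Venture `LatticeQCDFlow` (cell pub-lqcd), sub-topic `Scoring`; FANOUT row 5 (`s0-sun-a`), GEN-23.
NEW WORK of the cell (placement rule).  GEN-17's `BesselToeplitzAndreief` is the case `λ = 0` of the present
file: on the Weyl torus of `U(N)`, for ANY two exponent vectors `α, β : Fin N → ℕ`, the Wilson weight
`Π_b e^{x cos θ_b}` integrated against the pair of alternants `a_α(e^{iθ}) conj a_β(e^{iθ})` (the tree's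
`SchurPolynomials.alternant`) is a Toeplitz-like Bessel determinant:

* `integral_cube_prod_cexp_cos_mul_alternant_mul_conj_alternant`:
  **`∫_{(−π,π]^N} (Π_b e^{x cos θ_b}) a_α(e^{iθ}) conj a_β(e^{iθ}) dθ = (2π)^N N! det[I_{|α_i − β_j|}(x)]_{i,j}`**
  (double Leibniz expansion, the one-angle Fourier coefficients `∫ e^{x cos θ} e^{imθ} = 2π I_{|m|}(x)` of GEN-17,
  Andréief's identity `Σ_{σ,τ} sgn σ sgn τ Π_b A(σ⁻¹b, τ⁻¹b) = N! det A`);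
* `integral_cube_alternant_mul_conj_alternant` (`x = 0`, by orthogonality of the characters of the torus instead):
  **`∫ a_{λ+ρ} conj a_{μ+ρ} dθ = (2π)^N N! [λ = μ]`** for antitone `λ, μ` — with the bialternant formula
  `a_{λ+ρ} = s_λ a_ρ` (the tree's `alternant_add_rho`) this is WEYL'S ORTHOGONALITY OF THE `U(N)` CHARACTERS in
  angle coordinates, `((2π)^N N!)⁻¹ ∫ s_λ(e^{iθ}) conj s_μ(e^{iθ}) |Δ(θ)|² dθ = [λ = μ]`
  (`integral_cube_schur_mul_conj_schur_mul_norm_sq`);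
* `integral_cube_prod_cexp_cos_mul_conj_schur_mul_norm_sq`: **THE CHARACTER COEFFICIENTS OF THE ONE-PLAQUETTE
  WEIGHT FOR EVERY `N`** — `∫ (Π_b e^{x cos θ_b}) conj s_λ(e^{iθ}) |a_ρ(e^{iθ})|² dθ = (2π)^N N! det[I_{|ρ_i − λ_j − ρ_j|}(x)]`,
  i.e. `⟨χ_λ, e^{x Re tr U}⟩_{U(N)} = det[I_{|λ_j − j + i|}(x)]` (Bars 1980 / Drouffe–Zuber 1983, (3.7)): the input of
  every character (strong-coupling) expansion of two-dimensional `U(N)` lattice gauge theory, generalising the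
  `SU(2)` coefficients of GEN-9 (`SU2CharacterExpansion`) and the `λ = 0` partition function of GEN-17 to all `N`, `λ`.

* §5 `integral_cube_prod_cexp_cos_mul_norm_sq_sum_mul_norm_sq`: THE ADJOINT CHANNEL — `(Σ_b z_b) a_ρ = a_{ρ+e₀}` (one-box
  Pieri) gives `∫ (Π e^{x cos θ_b}) |Σ_b e^{iθ_b}|² |a_ρ|² dθ = (2π)^N N! det[I_{|α_i − α_j|}(x)]`, `α = (N, N−2, …, 0)`, i.e.
  `∫_{U(N)} |tr U|² e^{x Re tr U} dU` in closed determinant form.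

References (context): I. Bars, J. Math. Phys. 21 (1980) 2678; J.-M. Drouffe, J.-B. Zuber, Phys. Rept. 102 (1983) 1,
§3.  No `def`, no named fact, 0 sorry.
-/

noncomputable section

open Real MeasureTheory Finset Complex Equiv
open scoped ENNReal ComplexConjugate
open Literature.Analysis.FunctionSpaces
open Literature.RepresentationTheory.CompactGroups.WeylIntegration
open Literature.RingTheory.SymmetricFunctions.SymmPoly (alternant alternant_eq_sum rho schur alternant_add_rho
  eq_of_add_rho_comp_perm_eq)

namespace Summit.Ventures.LatticeQCDFlow.Scoring

variable {N : ℕ}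

/-! ### 2. The weighted alternant pairing: `∫ (Π e^{x cos θ_b}) a_α conj a_β = (2π)^N N! det[I_{|α_i − β_j|}(x)]` -/

/-- **`∫_{(−π,π]^N} (Π_b e^{x cos θ_b}) a_α(e^{iθ}) conj a_β(e^{iθ}) dθ = (2π)^N · N! · det[I_{|α_i − β_j|}(x)]_{i,j}`** for
every real `x` and all exponent vectors `α, β`. -/
theorem integral_cube_prod_cexp_cos_mul_alternant_mul_conj_alternant (x : ℝ) (α β : Fin N → ℕ) :
    ∫ θ, (∏ b, cexp ((x : ℂ) * Real.cos (θ b))) * (alternant (fun b => cexp (θ b * I)) α *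
        conj (alternant (fun b => cexp (θ b * I)) β))
        ∂(Measure.pi fun _ : Fin N => (volume : Measure ℝ).restrict (Set.Ioc (-π) π))
      = (2 * π : ℂ) ^ N * N.factorial *
          (Matrix.of fun i j : Fin N => (besselI (((α i : ℕ) : ℤ) - ((β j : ℕ) : ℤ)).natAbs x : ℂ)).det := by
  simp_rw [prod_cexp_cos_mul_alternant_mul_conj_alternant_eq_sum]
  rw [integral_finsetSum _ (fun σ _ => integrable_finsetSum _ fun τ _ =>
    (integrable_cube_weighted_term' x _).const_mul _)]
  simp_rw [integral_finsetSum _ (fun τ _ => (integrable_cube_weighted_term' x _).const_mul _), integral_const_mul]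
  have hI : ∀ σ τ : Perm (Fin N),
      ∫ θ : Fin N → ℝ, ∏ b, (cexp ((x : ℂ) * Real.cos (θ b)) *
          cexp ((((α (σ.symm b) : ℕ) : ℤ) - ((β (τ.symm b) : ℕ) : ℤ) : ℤ) * θ b * I))
        ∂(Measure.pi fun _ : Fin N => (volume : Measure ℝ).restrict (Set.Ioc (-π) π))
      = (2 * π : ℂ) ^ N * ∏ b, (besselI (((α (σ.symm b) : ℕ) : ℤ) - ((β (τ.symm b) : ℕ) : ℤ)).natAbs x : ℂ) := by
    intro σ τ
    rw [integral_fintype_prod_eq_prod (𝕜 := ℂ) (fun b (θ : ℝ) => cexp ((x : ℂ) * Real.cos θ) *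
      cexp ((((α (σ.symm b) : ℕ) : ℤ) - ((β (τ.symm b) : ℕ) : ℤ) : ℤ) * θ * I))]
    simp_rw [integral_Ioc_cexp_mul_cos_mul_cexp_int]
    rw [Finset.prod_mul_distrib, Finset.prod_const, Finset.card_univ, Fintype.card_fin]
  simp_rw [hI]
  have hterm : ∀ σ τ : Perm (Fin N), ((Equiv.Perm.sign σ : ℤ) : ℂ) * ((Equiv.Perm.sign τ : ℤ) : ℂ) *
      ((2 * π : ℂ) ^ N * ∏ b, (besselI (((α (σ.symm b) : ℕ) : ℤ) - ((β (τ.symm b) : ℕ) : ℤ)).natAbs x : ℂ))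
      = (2 * π : ℂ) ^ N * (((Equiv.Perm.sign σ : ℤ) : ℂ) * ((Equiv.Perm.sign τ : ℤ) : ℂ) *
        ∏ b, (besselI (((α (σ.symm b) : ℕ) : ℤ) - ((β (τ.symm b) : ℕ) : ℤ)).natAbs x : ℂ)) := by
    intro σ τ; ring
  simp_rw [hterm, ← Finset.mul_sum]
  have key := sum_sum_sign_mul_sign_mul_prod_eq_factorial_mul_det
    (Matrix.of fun i j : Fin N => (besselI (((α i : ℕ) : ℤ) - ((β j : ℕ) : ℤ)).natAbs x : ℂ))
  simp only [Matrix.of_apply, Fintype.card_fin] at key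
  rw [key, mul_assoc]

/-! ### 3. Weyl's orthogonality of the `U(N)` characters on the torus -/

/-- **`∫_{(−π,π]^N} a_{λ+ρ}(e^{iθ}) conj a_{μ+ρ}(e^{iθ}) dθ = (2π)^N N! [λ = μ]`** for antitone `λ`, `μ` (orthogonality
of the characters of the torus; two strictly decreasing exponent vectors that are permutations of each other are
equal, the tree's `eq_of_add_rho_comp_perm_eq`). -/
theorem integral_cube_alternant_mul_conj_alternant {la mu : Fin N → ℕ} (hla : Antitone la) (hmu : Antitone mu) :
    ∫ θ, alternant (fun b => cexp (θ b * I)) (la + rho N) * conj (alternant (fun b => cexp (θ b * I)) (mu + rho N))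
        ∂(Measure.pi fun _ : Fin N => (volume : Measure ℝ).restrict (Set.Ioc (-π) π))
      = if la = mu then (2 * π : ℂ) ^ N * N.factorial else 0 := by
  have h0 := prod_cexp_cos_mul_alternant_mul_conj_alternant_eq_sum 0 (la + rho N) (mu + rho N)
  simp only [Complex.ofReal_zero, zero_mul, Complex.exp_zero, Finset.prod_const_one, one_mul] at h0
  simp_rw [h0]
  rw [integral_finsetSum _ (fun σ _ => integrable_finsetSum _ fun τ _ =>
    (integrable_cube_prod_cexp_int _).const_mul _)]
  simp_rw [integral_finsetSum _ (fun τ _ => (integrable_cube_prod_cexp_int _).const_mul _), integral_const_mul]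
  have hI : ∀ σ τ : Perm (Fin N),
      ∫ θ : Fin N → ℝ, ∏ b, cexp (((((la + rho N) (σ.symm b) : ℕ) : ℤ) - (((mu + rho N) (τ.symm b) : ℕ) : ℤ) : ℤ) * θ b * I)
        ∂(Measure.pi fun _ : Fin N => (volume : Measure ℝ).restrict (Set.Ioc (-π) π))
      = if (fun b => (((la + rho N) (σ.symm b) : ℕ) : ℤ) - (((mu + rho N) (τ.symm b) : ℕ) : ℤ)) = 0
        then (2 * π : ℂ) ^ N else 0 := by
    intro σ τ
    have h := integral_cube_prod_cexp (n := Fin N)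
      (fun b => (((la + rho N) (σ.symm b) : ℕ) : ℤ) - (((mu + rho N) (τ.symm b) : ℕ) : ℤ))
    simp only [Fintype.card_fin] at h
    exact h
  -- the exponent vanishes iff `la = mu` and `σ = τ`
  have hzero : ∀ σ τ : Perm (Fin N),
      (fun b => (((la + rho N) (σ.symm b) : ℕ) : ℤ) - (((mu + rho N) (τ.symm b) : ℕ) : ℤ)) = 0 → la = mu ∧ σ = τ := by
    intro σ τ hz
    have hcomp : (la + rho N) ∘ σ.symm = (mu + rho N) ∘ τ.symm := _root_.funext fun b => by
      have hb := congrFun hz b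
      simp only [Pi.zero_apply, sub_eq_zero, Nat.cast_inj] at hb
      exact hb
    obtain ⟨h1, h2⟩ := eq_of_add_rho_comp_perm_eq hla hmu hcomp
    exact ⟨h1, by simpa using congrArg Equiv.symm h2⟩
  simp_rw [hI]
  have hsq : ∀ σ : Perm (Fin N), ((Equiv.Perm.sign σ : ℤ) : ℂ) * ((Equiv.Perm.sign σ : ℤ) : ℂ) = 1 := fun σ => by
    rw [← Int.cast_mul, ← Units.val_mul, Int.units_mul_self, Units.val_one, Int.cast_one]
  by_cases hlm : la = mu
  · subst hlm
    rw [if_pos rfl]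
    have hinner : ∀ σ : Perm (Fin N), ∑ τ : Perm (Fin N), ((Equiv.Perm.sign σ : ℤ) : ℂ) * ((Equiv.Perm.sign τ : ℤ) : ℂ) *
        (if (fun b => (((la + rho N) (σ.symm b) : ℕ) : ℤ) - (((la + rho N) (τ.symm b) : ℕ) : ℤ)) = 0
          then (2 * π : ℂ) ^ N else 0) = (2 * π : ℂ) ^ N := by
      intro σ
      rw [Finset.sum_eq_single σ (fun τ _ hτ => by rw [if_neg (fun hz => hτ ((hzero σ τ hz).2.symm)), mul_zero])
        (fun h => absurd (Finset.mem_univ σ) h), if_pos (_root_.funext fun b => by simp), hsq, one_mul]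
    simp_rw [hinner, Finset.sum_const, Finset.card_univ, Fintype.card_perm, Fintype.card_fin, nsmul_eq_mul]
    ring
  · rw [if_neg hlm]
    refine Finset.sum_eq_zero fun σ _ => Finset.sum_eq_zero fun τ _ => ?_
    rw [if_neg (fun hz => hlm (hzero σ τ hz).1), mul_zero]

/-- **WEYL'S ORTHOGONALITY OF THE `U(N)` CHARACTERS, ANGLE FORM**: for antitone `λ, μ` (partitions with at most `N`
parts), `∫_{(−π,π]^N} s_λ(e^{iθ}) conj s_μ(e^{iθ}) |a_ρ(e^{iθ})|² dθ = (2π)^N N! [λ = μ]` — with `|a_ρ|² = |Δ|²` the Weyl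
density, so the Schur polynomials (the `U(N)` characters restricted to the torus) are orthonormal for
`((2π)^N N!)⁻¹ |Δ|² dθ`. -/
theorem integral_cube_schur_mul_conj_schur_mul_norm_sq {la mu : Fin N → ℕ} (hla : Antitone la) (hmu : Antitone mu) :
    ∫ θ, schur (fun b => cexp (θ b * I)) la * conj (schur (fun b => cexp (θ b * I)) mu) *
        ((‖alternant (fun b => cexp (θ b * I)) (rho N)‖ ^ 2 : ℝ) : ℂ)
        ∂(Measure.pi fun _ : Fin N => (volume : Measure ℝ).restrict (Set.Ioc (-π) π))
      = if la = mu then (2 * π : ℂ) ^ N * N.factorial else 0 := by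
  rw [← integral_cube_alternant_mul_conj_alternant hla hmu]
  refine integral_congr_ae (Filter.Eventually.of_forall fun θ => ?_)
  dsimp only
  rw [alternant_add_rho, alternant_add_rho, map_mul, ← Complex.normSq_eq_norm_sq, ← Complex.mul_conj]
  ring

/-! ### 4. The character coefficients of the one-plaquette weight, every `N` -/

/-- **THE `U(N)` CHARACTER COEFFICIENTS OF THE WILSON ONE-PLAQUETTE WEIGHT, FOR EVERY `N`**:
`∫_{(−π,π]^N} (Π_b e^{x cos θ_b}) conj s_λ(e^{iθ}) |a_ρ(e^{iθ})|² dθ = (2π)^N N! det[I_{|ρ_i − λ_j − ρ_j|}(x)]_{i,j}`, i.e. with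
Weyl's formula `∫_{U(N)} e^{x Re tr U} conj χ_λ(U) dU = det[I_{|λ_j − j + i|}(x)]` — the coefficient of the character
`χ_λ` in the character expansion of `e^{x Re tr U}` (`λ = 0`: GEN-17's `det[I_{|i−j|}(x)]`). -/
theorem integral_cube_prod_cexp_cos_mul_conj_schur_mul_norm_sq (x : ℝ) (la : Fin N → ℕ) :
    ∫ θ, (∏ b, cexp ((x : ℂ) * Real.cos (θ b))) * (conj (schur (fun b => cexp (θ b * I)) la) *
        ((‖alternant (fun b => cexp (θ b * I)) (rho N)‖ ^ 2 : ℝ) : ℂ))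
        ∂(Measure.pi fun _ : Fin N => (volume : Measure ℝ).restrict (Set.Ioc (-π) π))
      = (2 * π : ℂ) ^ N * N.factorial *
          (Matrix.of fun i j : Fin N => (besselI (((rho N i : ℕ) : ℤ) - (((la + rho N) j : ℕ) : ℤ)).natAbs x : ℂ)).det := by
  rw [← integral_cube_prod_cexp_cos_mul_alternant_mul_conj_alternant x (rho N) (la + rho N)]
  refine integral_congr_ae (Filter.Eventually.of_forall fun θ => ?_)
  dsimp only
  rw [alternant_add_rho, map_mul, ← Complex.normSq_eq_norm_sq, ← Complex.mul_conj]
  ring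

/-! ### 5. The adjoint channel: `∫ (Π e^{x cos θ_b}) |Σ_b e^{iθ_b}|² |a_ρ|² dθ = (2π)^N N! det[I_{|α_i − α_j|}(x)]`, `α = ρ + e₀` -/

/-- **Pieri for one box, Leibniz form**: `(Σ_b z_b) · a_μ(z) = Σ_j a_{μ + e_j}(z)` for any point `z` and exponents `μ`. -/
theorem sum_mul_alternant_eq_sum_alternant_add_single {R : Type*} [CommRing R] (z : Fin N → R) (μ : Fin N → ℕ) :
    (∑ b, z b) * alternant z μ = ∑ j, alternant z (μ + (Pi.single j (1 : ℕ) : Fin N → ℕ)) := by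
  simp_rw [alternant_eq_sum]
  rw [Finset.mul_sum, Finset.sum_comm]
  refine Finset.sum_congr rfl fun σ _ => ?_
  have hP : ∀ j, ∏ i, z (σ i) ^ (μ + (Pi.single j (1 : ℕ) : Fin N → ℕ)) i = z (σ j) * ∏ i, z (σ i) ^ μ i := by
    intro j
    have h1 : ∀ i, z (σ i) ^ (μ + (Pi.single j (1 : ℕ) : Fin N → ℕ)) i = z (σ i) ^ μ i * (if i = j then z (σ i) else 1) := by
      intro i
      rw [Pi.add_apply, pow_add]
      by_cases hij : i = j
      · subst hij; rw [Pi.single_eq_same, pow_one, if_pos rfl]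
      · rw [Pi.single_eq_of_ne hij, pow_zero, if_neg hij]
    simp_rw [h1]
    rw [Finset.prod_mul_distrib, Finset.prod_ite_eq' univ j, if_pos (mem_univ j), mul_comm]
  simp_rw [hP]
  have hs : ∑ j, ((Equiv.Perm.sign σ : ℤ) : R) * (z (σ j) * ∏ i, z (σ i) ^ μ i)
      = (∑ j, z (σ j)) * (((Equiv.Perm.sign σ : ℤ) : R) * ∏ i, z (σ i) ^ μ i) := by
    rw [Finset.sum_mul]
    exact Finset.sum_congr rfl fun j _ => by ring
  rw [hs, Equiv.sum_comp σ z]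

/-- Adding a box below the first row of the staircase gives a repeated exponent: `a_{ρ + e_j} = 0` for `j ≠ 0`. -/
theorem alternant_rho_add_single_eq_zero {R : Type*} [CommRing R] (z : Fin N → R) {j : Fin N} (hj : (j : ℕ) ≠ 0) :
    alternant z (rho N + (Pi.single j (1 : ℕ) : Fin N → ℕ)) = 0 := by
  have hj0 : 0 < (j : ℕ) := Nat.pos_of_ne_zero hj
  have hjN : (j : ℕ) - 1 < N := by have := j.2; omega
  have hne : (⟨(j : ℕ) - 1, hjN⟩ : Fin N) ≠ j := fun h => by have := congrArg Fin.val h; dsimp at this; omega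
  refine Literature.RingTheory.SymmetricFunctions.SymmPoly.alternant_eq_zero_of_apply_eq z hne ?_
  rw [Pi.add_apply, Pi.add_apply, Pi.single_eq_same, Pi.single_eq_of_ne hne, add_zero,
    Literature.RingTheory.SymmetricFunctions.SymmPoly.rho_apply,
    Literature.RingTheory.SymmetricFunctions.SymmPoly.rho_apply]
  dsimp only
  omega

/-- **`(Σ_b z_b) a_ρ(z) = a_{ρ+e₀}(z)`** (`N ≥ 1`): the first power sum times the Vandermonde alternant adds one box to
the first row. -/
theorem sum_mul_alternant_rho (hN : 0 < N) {R : Type*} [CommRing R] (z : Fin N → R) :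
    (∑ b, z b) * alternant z (rho N) = alternant z (rho N + (Pi.single (⟨0, hN⟩ : Fin N) (1 : ℕ) : Fin N → ℕ)) := by
  rw [sum_mul_alternant_eq_sum_alternant_add_single, Finset.sum_eq_single (⟨0, hN⟩ : Fin N)
    (fun j _ hj => alternant_rho_add_single_eq_zero z (fun h => hj (Fin.ext h)))
    (fun h => absurd (mem_univ _) h)]

/-- **THE ADJOINT CHANNEL OF THE ONE-PLAQUETTE WEIGHT, EVERY `N ≥ 1`**:
`∫_{(−π,π]^N} (Π_b e^{x cos θ_b}) |Σ_b e^{iθ_b}|² |a_ρ(e^{iθ})|² dθ = (2π)^N N! det[I_{|α_i − α_j|}(x)]`, `α = ρ + e₀ =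
(N, N−2, N−3, …, 0)` — with Weyl's formula, `∫_{U(N)} |tr U|² e^{x Re tr U} dU = det[I_{|α_i−α_j|}(x)]`, the numerator
of the adjoint plaquette `⟨|tr U_p|²⟩_β` of GEN-20's `AdjointPlaquetteWeakCoupling` in closed determinant form. -/
theorem integral_cube_prod_cexp_cos_mul_norm_sq_sum_mul_norm_sq (hN : 0 < N) (x : ℝ) :
    ∫ θ, (∏ b, cexp ((x : ℂ) * Real.cos (θ b))) * (((‖∑ b, cexp (θ b * I)‖ ^ 2 : ℝ) : ℂ) *
        ((‖alternant (fun b => cexp (θ b * I)) (rho N)‖ ^ 2 : ℝ) : ℂ))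
        ∂(Measure.pi fun _ : Fin N => (volume : Measure ℝ).restrict (Set.Ioc (-π) π))
      = (2 * π : ℂ) ^ N * N.factorial *
          (Matrix.of fun i j : Fin N => (besselI ((((rho N + (Pi.single (⟨0, hN⟩ : Fin N) (1 : ℕ) : Fin N → ℕ)) i : ℕ) : ℤ) -
            (((rho N + (Pi.single (⟨0, hN⟩ : Fin N) (1 : ℕ) : Fin N → ℕ)) j : ℕ) : ℤ)).natAbs x : ℂ)).det := by
  rw [← integral_cube_prod_cexp_cos_mul_alternant_mul_conj_alternant x]
  refine integral_congr_ae (Filter.Eventually.of_forall fun θ => ?_)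
  dsimp only
  rw [← sum_mul_alternant_rho hN, map_mul, ← Complex.normSq_eq_norm_sq, ← Complex.normSq_eq_norm_sq,
    ← Complex.mul_conj, ← Complex.mul_conj]
  ring

/-- **`∫_{U(N)} |tr U|² e^{x Re tr U} dU = det[I_{|α_i − α_j|}(x)]`, `α = (N, N−2, N−3, …, 0)`** (`N ≥ 1`): the
adjoint-channel generating function of the `U(N)` one-plaquette law on the Haar measure (Weyl's formula in Bochner form,
`TorusParsevalPairing`), so that GEN-20's adjoint plaquette is `⟨|tr U_p|²⟩_β = det[I_{|α_i−α_j|}(β)] / det[I_{|i−j|}(β)]`. -/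
theorem integral_haar_unitaryGroup_normSq_trace_mul_exp (hN : 0 < N) (x : ℝ) :
    ∫ u, ‖((u : Matrix.unitaryGroup (Fin N) ℂ) : Matrix (Fin N) (Fin N) ℂ).trace‖ ^ 2 *
        Real.exp (x * ((u : Matrix.unitaryGroup (Fin N) ℂ) : Matrix (Fin N) (Fin N) ℂ).trace.re)
        ∂(Literature.MathematicalPhysics.QuantumFieldTheory.haarProbability (Matrix.unitaryGroup (Fin N) ℂ))
      = (Matrix.of fun i j : Fin N => besselI ((((rho N + (Pi.single (⟨0, hN⟩ : Fin N) (1 : ℕ) : Fin N → ℕ)) i : ℕ) : ℤ) -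
          (((rho N + (Pi.single (⟨0, hN⟩ : Fin N) (1 : ℕ) : Fin N → ℕ)) j : ℕ) : ℤ)).natAbs x).det := by
  have hc : Continuous fun u : Matrix.unitaryGroup (Fin N) ℂ =>
      ‖((u : Matrix.unitaryGroup (Fin N) ℂ) : Matrix (Fin N) (Fin N) ℂ).trace‖ ^ 2 *
        Real.exp (x * ((u : Matrix.unitaryGroup (Fin N) ℂ) : Matrix (Fin N) (Fin N) ℂ).trace.re) :=
    ((continuous_id.matrix_trace.comp continuous_subtype_val).norm.pow 2).mul
      (Real.continuous_exp.comp (continuous_const.mul (Complex.continuous_re.comp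
        (continuous_id.matrix_trace.comp continuous_subtype_val))))
  have hcl : ∀ a u : Matrix.unitaryGroup (Fin N) ℂ,
      ‖(((a * u * a⁻¹ : Matrix.unitaryGroup (Fin N) ℂ)) : Matrix (Fin N) (Fin N) ℂ).trace‖ ^ 2 *
        Real.exp (x * (((a * u * a⁻¹ : Matrix.unitaryGroup (Fin N) ℂ)) : Matrix (Fin N) (Fin N) ℂ).trace.re)
      = ‖((u : Matrix.unitaryGroup (Fin N) ℂ) : Matrix (Fin N) (Fin N) ℂ).trace‖ ^ 2 *
        Real.exp (x * ((u : Matrix.unitaryGroup (Fin N) ℂ) : Matrix (Fin N) (Fin N) ℂ).trace.re) := by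
    intro a u; rw [trace_conj_unitaryGroup]
  rw [integral_unitaryGroup_eq_integral_cube_real hc hcl]
  -- the cube integrand, in complex form, is `(Π e^{x cos θ_b}) |Σ e^{iθ_b}|² |a_ρ|²`
  have hcos : ∀ (θ : Fin N → ℝ) (b : Fin N), (cexp (θ b * I)).re = Real.cos (θ b) := fun θ b => by
    rw [show (θ b : ℂ) * I = ((θ b : ℝ) : ℂ) * I from rfl, Complex.exp_ofReal_mul_I_re]
  have hθ : ∀ θ : Fin N → ℝ,
      ((‖(((torusPt θ : Literature.LinearAlgebra.Matrix.diagonalTorus (Fin N)) : Matrix.unitaryGroup (Fin N) ℂ) :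
          Matrix (Fin N) (Fin N) ℂ).trace‖ ^ 2 *
        Real.exp (x * ((((torusPt θ : Literature.LinearAlgebra.Matrix.diagonalTorus (Fin N)) : Matrix.unitaryGroup (Fin N) ℂ) :
          Matrix (Fin N) (Fin N) ℂ).trace).re) *
        ∏ p : OD (Fin N), ‖cexp (θ p.1.1 * I) - cexp (θ p.1.2 * I)‖ ^ 2 : ℝ) : ℂ)
      = (∏ b, cexp ((x : ℂ) * Real.cos (θ b))) * (((‖∑ b, cexp (θ b * I)‖ ^ 2 : ℝ) : ℂ) *
          ((‖alternant (fun b => cexp (θ b * I)) (rho N)‖ ^ 2 : ℝ) : ℂ)) := by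
    intro θ
    rw [coe_torusPt, Matrix.trace_diagonal, prod_OD_norm_sub_sq_eq_norm_vdm_sq, ← norm_alternant_rho_eq_norm_vdm,
      Complex.re_sum]
    simp_rw [hcos]
    push_cast
    rw [Finset.mul_sum, Complex.exp_sum]
    ring
  have hint := integral_cube_prod_cexp_cos_mul_norm_sq_sum_mul_norm_sq hN x
  rw [← Complex.ofReal_inj, Complex.ofReal_mul, ← integral_complex_ofReal]
  simp_rw [hθ]
  rw [hint]
  push_cast
  have hdet : ∀ M : Matrix (Fin N) (Fin N) ℝ, ((M.det : ℝ) : ℂ) = (M.map ((↑) : ℝ → ℂ)).det := fun M => by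
    rw [show ((M.det : ℝ) : ℂ) = Complex.ofRealHom M.det from rfl, RingHom.map_det, RingHom.mapMatrix_apply]
    rfl
  have hM : ((Matrix.of fun i j : Fin N =>
      besselI ((((rho N + (Pi.single (⟨0, hN⟩ : Fin N) (1 : ℕ) : Fin N → ℕ)) i : ℕ) : ℤ) -
        (((rho N + (Pi.single (⟨0, hN⟩ : Fin N) (1 : ℕ) : Fin N → ℕ)) j : ℕ) : ℤ)).natAbs x).map ((↑) : ℝ → ℂ))
      = Matrix.of fun i j : Fin N => (besselI ((((rho N + (Pi.single (⟨0, hN⟩ : Fin N) (1 : ℕ) : Fin N → ℕ)) i : ℕ) : ℤ) -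
        (((rho N + (Pi.single (⟨0, hN⟩ : Fin N) (1 : ℕ) : Fin N → ℕ)) j : ℕ) : ℤ)).natAbs x : ℂ) := by
    ext i j; rfl
  have h1 : (2 * (π : ℂ)) ^ N ≠ 0 := pow_ne_zero _ (mul_ne_zero two_ne_zero (Complex.ofReal_ne_zero.mpr Real.pi_ne_zero))
  have h2 : ((N.factorial : ℕ) : ℂ) ≠ 0 := Nat.cast_ne_zero.mpr (Nat.factorial_ne_zero _)
  rw [hdet, hM, ← mul_assoc, inv_mul_cancel₀ (mul_ne_zero h1 h2), one_mul]

/-! ### 6. Haar-measure form: character orthonormality and character coefficients for class functions -/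

/-- **WEYL CHARACTER ORTHONORMALITY ON HAAR `U(N)`**: if `F, G` are continuous class functions on `U(N)` whose
restrictions to the torus satisfy `F(diag e^{iθ}) · a_ρ(e^{iθ}) = a_{λ+ρ}(e^{iθ})` and `G · a_ρ = a_{μ+ρ}` (i.e. `F, G` are
the characters `s_λ, s_μ`, `λ, μ` antitone), then `∫_{U(N)} F conj G dU = [λ = μ]`. -/
theorem integral_haar_unitaryGroup_classFun_mul_conj {F G : Matrix.unitaryGroup (Fin N) ℂ → ℂ} (hF : Continuous F)
    (hG : Continuous G) (hFcl : ∀ a u, F (a * u * a⁻¹) = F u) (hGcl : ∀ a u, G (a * u * a⁻¹) = G u)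
    {la mu : Fin N → ℕ} (hla : Antitone la) (hmu : Antitone mu)
    (hFT : ∀ θ : Fin N → ℝ,
      F ((torusPt θ : Literature.LinearAlgebra.Matrix.diagonalTorus (Fin N)) : Matrix.unitaryGroup (Fin N) ℂ) *
        alternant (fun b => cexp (θ b * I)) (rho N) = alternant (fun b => cexp (θ b * I)) (la + rho N))
    (hGT : ∀ θ : Fin N → ℝ,
      G ((torusPt θ : Literature.LinearAlgebra.Matrix.diagonalTorus (Fin N)) : Matrix.unitaryGroup (Fin N) ℂ) *
        alternant (fun b => cexp (θ b * I)) (rho N) = alternant (fun b => cexp (θ b * I)) (mu + rho N)) :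
    ∫ u, F u * conj (G u) ∂(Literature.MathematicalPhysics.QuantumFieldTheory.haarProbability (Matrix.unitaryGroup (Fin N) ℂ))
      = if la = mu then 1 else 0 := by
  have hc : Continuous fun u : Matrix.unitaryGroup (Fin N) ℂ => F u * conj (G u) :=
    hF.mul (Complex.continuous_conj.comp hG)
  rw [integral_unitaryGroup_eq_integral_cube_complex hc (fun a u => by rw [hFcl, hGcl])]
  have hθ : ∀ θ : Fin N → ℝ,
      F ((torusPt θ : Literature.LinearAlgebra.Matrix.diagonalTorus (Fin N)) : Matrix.unitaryGroup (Fin N) ℂ) *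
          conj (G ((torusPt θ : Literature.LinearAlgebra.Matrix.diagonalTorus (Fin N)) : Matrix.unitaryGroup (Fin N) ℂ)) *
        ((∏ p : OD (Fin N), ‖cexp (θ p.1.1 * I) - cexp (θ p.1.2 * I)‖ ^ 2 : ℝ) : ℂ)
      = alternant (fun b => cexp (θ b * I)) (la + rho N) * conj (alternant (fun b => cexp (θ b * I)) (mu + rho N)) := by
    intro θ
    rw [prod_OD_norm_sub_sq_eq_norm_vdm_sq, ← norm_alternant_rho_eq_norm_vdm, ← Complex.normSq_eq_norm_sq,
      ← Complex.mul_conj, ← hFT, ← hGT, map_mul]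
    ring
  simp_rw [hθ]
  rw [integral_cube_alternant_mul_conj_alternant hla hmu]
  have h1 : (2 * (π : ℂ)) ^ N ≠ 0 := pow_ne_zero _ (mul_ne_zero two_ne_zero (Complex.ofReal_ne_zero.mpr Real.pi_ne_zero))
  have h2 : ((N.factorial : ℕ) : ℂ) ≠ 0 := Nat.cast_ne_zero.mpr (Nat.factorial_ne_zero _)
  split_ifs
  · push_cast
    rw [inv_mul_cancel₀ (mul_ne_zero h1 h2)]
  · rw [mul_zero]

/-- **THE `U(N)` CHARACTER COEFFICIENTS ON HAAR MEASURE**: for a continuous class function `F` with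
`F · a_ρ = a_{λ+ρ}` on the torus (the character `s_λ`),
`∫_{U(N)} conj F(U) · e^{x Re tr U} dU = det[ I_{|ρ_i − (λ+ρ)_j|}(x) ]_{i,j}` — the coefficient of `s_λ` in the character
expansion of the one-plaquette weight `e^{x Re tr U}` (Bars 1980 / Drouffe–Zuber: `det[I_{λ_j − j + i}(x)]`). -/
theorem integral_haar_unitaryGroup_conj_classFun_mul_exp {F : Matrix.unitaryGroup (Fin N) ℂ → ℂ} (hF : Continuous F)
    (hFcl : ∀ a u, F (a * u * a⁻¹) = F u) {la : Fin N → ℕ}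
    (hFT : ∀ θ : Fin N → ℝ,
      F ((torusPt θ : Literature.LinearAlgebra.Matrix.diagonalTorus (Fin N)) : Matrix.unitaryGroup (Fin N) ℂ) *
        alternant (fun b => cexp (θ b * I)) (rho N) = alternant (fun b => cexp (θ b * I)) (la + rho N)) (x : ℝ) :
    ∫ u, conj (F u) * cexp ((x : ℂ) * ((u : Matrix.unitaryGroup (Fin N) ℂ) : Matrix (Fin N) (Fin N) ℂ).trace.re)
        ∂(Literature.MathematicalPhysics.QuantumFieldTheory.haarProbability (Matrix.unitaryGroup (Fin N) ℂ))
      = (Matrix.of fun i j : Fin N => (besselI (((rho N i : ℕ) : ℤ) - (((la + rho N) j : ℕ) : ℤ)).natAbs x : ℂ)).det := by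
  have hc : Continuous fun u : Matrix.unitaryGroup (Fin N) ℂ =>
      conj (F u) * cexp ((x : ℂ) * ((u : Matrix.unitaryGroup (Fin N) ℂ) : Matrix (Fin N) (Fin N) ℂ).trace.re) :=
    (Complex.continuous_conj.comp hF).mul (Complex.continuous_exp.comp (continuous_const.mul
      (Complex.continuous_ofReal.comp (Complex.continuous_re.comp (continuous_id.matrix_trace.comp continuous_subtype_val)))))
  rw [integral_unitaryGroup_eq_integral_cube_complex hc (fun a u => by rw [hFcl, trace_conj_unitaryGroup])]
  have hcos : ∀ (θ : Fin N → ℝ) (b : Fin N), (cexp (θ b * I)).re = Real.cos (θ b) := fun θ b => by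
    rw [show (θ b : ℂ) * I = ((θ b : ℝ) : ℂ) * I from rfl, Complex.exp_ofReal_mul_I_re]
  have hθ : ∀ θ : Fin N → ℝ,
      conj (F ((torusPt θ : Literature.LinearAlgebra.Matrix.diagonalTorus (Fin N)) : Matrix.unitaryGroup (Fin N) ℂ)) *
          cexp ((x : ℂ) * (((torusPt θ : Literature.LinearAlgebra.Matrix.diagonalTorus (Fin N)) :
            Matrix.unitaryGroup (Fin N) ℂ) : Matrix (Fin N) (Fin N) ℂ).trace.re) *
        ((∏ p : OD (Fin N), ‖cexp (θ p.1.1 * I) - cexp (θ p.1.2 * I)‖ ^ 2 : ℝ) : ℂ)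
      = (∏ b, cexp ((x : ℂ) * Real.cos (θ b))) * (alternant (fun b => cexp (θ b * I)) (rho N) *
          conj (alternant (fun b => cexp (θ b * I)) (la + rho N))) := by
    intro θ
    rw [prod_OD_norm_sub_sq_eq_norm_vdm_sq, ← norm_alternant_rho_eq_norm_vdm, ← Complex.normSq_eq_norm_sq,
      ← Complex.mul_conj, ← hFT, map_mul, trace_torusPt, Complex.re_sum]
    simp_rw [hcos]
    push_cast
    rw [Finset.mul_sum, Complex.exp_sum]
    ring
  simp_rw [hθ]
  rw [integral_cube_prod_cexp_cos_mul_alternant_mul_conj_alternant x (rho N) (la + rho N)]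
  have h1 : (2 * (π : ℂ)) ^ N ≠ 0 := pow_ne_zero _ (mul_ne_zero two_ne_zero (Complex.ofReal_ne_zero.mpr Real.pi_ne_zero))
  have h2 : ((N.factorial : ℕ) : ℂ) ≠ 0 := Nat.cast_ne_zero.mpr (Nat.factorial_ne_zero _)
  push_cast
  rw [← mul_assoc, inv_mul_cancel₀ (mul_ne_zero h1 h2), one_mul]

end Summit.Ventures.LatticeQCDFlow.Scoring
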